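import Mathlib
import HarnessLib
import Literature.MathematicalPhysics.StatisticalMechanics.RenormalisationMapCounting

/-!
# Absorbing the counting constants by Brydges' gain ([ABKM19] Lemma 9.6 (9.39) / Lemma 10.2)

The remainder bounds of the Lipschitz estimate of `S_k` (RenormalisationMapRemainderTwoLarge / Three /
Four) come out as `E · c^{|U|_{k+1}} · A^{−η(d)|U|_{k+1}}` with `c = c(d, L, κ, A_𝒫)` independent of `A`
and `η(d) > 1`.  The target norm `‖·‖_{k+1}^{(A)}` asks for `A^{−|U|_{k+1}}` (`NormParams.aFactor`).  For a
non-empty `U` and `A^{η−1} ≥ c` one has `c^{|U|} A^{−η|U|} = (cA^{−(η−1)})^{|U|} A^{−|U|} ≤ cA^{−(η−1)} · A^{−|U|}`,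
so the constant in front of `A^{−|U|_{k+1}}` is `E · cA^{−(η−1)}`, small for `A` large — the `largePartEps`
mechanism of [ABKM19] Lemma 10.2, here recorded once for all remainder sums.

* `rpow_neg_mul_natCast_eq` — `A^{−η n} = (A^{−(η−1)})^n (A^n)⁻¹`;
* **`pow_mul_rpow_le_inv_pow`** — `c^n A^{−η n} ≤ (c A^{−(η−1)}) (A^n)⁻¹` for `n ≥ 1`, `c ≤ A^{η−1}`;
* `pow_mul_rpow_le_inv_pow'` — the same with the weaker conclusion `≤ (A^n)⁻¹`.

Everything is proved; elementary real arithmetic.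

## References
* S. Adams, S. Buchholz, R. Kotecký, S. Müller, arXiv:1910.13564, proof of Lemma 9.6 (9.39) and of
  Lemma 10.2 (the constant `ε(A) → 0`) [AdamsBuchholzKoteckyMuller2019].
-/

noncomputable section

namespace Literature.MathematicalPhysics.StatisticalMechanics.TorusPolymer

/-- `A^{−η n} = (A^{−(η−1)})^n · (A^n)⁻¹` for `A > 0`. [cite: AdamsBuchholzKoteckyMuller2019, proof of Lemma 9.6 (9.39)] -/
theorem rpow_neg_mul_natCast_eq {A η : ℝ} (hA : 0 < A) (n : ℕ) :
    A ^ (-(η * n) : ℝ) = (A ^ (-(η - 1) : ℝ)) ^ n * (A ^ n)⁻¹ := by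
  have h1 : (-(η * n) : ℝ) = (-(η - 1)) * n + (-(n : ℝ)) := by ring
  rw [h1, Real.rpow_add hA, Real.rpow_mul hA.le, Real.rpow_natCast, Real.rpow_neg hA.le (n : ℝ),
    Real.rpow_natCast]

/-- **Absorbing the counting constant by the gain**: for `A ≥ 1`, `0 ≤ c ≤ A^{η−1}` and `n ≥ 1`,
`c^n A^{−η n} ≤ (c A^{−(η−1)}) · (A^n)⁻¹`. [cite: AdamsBuchholzKoteckyMuller2019, proof of Lemma 9.6 (9.39) / Lemma 10.2] -/
theorem pow_mul_rpow_le_inv_pow {A η c : ℝ} (hA : 1 ≤ A) (hc : 0 ≤ c) (hcA : c ≤ A ^ (η - 1 : ℝ))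
    {n : ℕ} (hn : 1 ≤ n) :
    c ^ n * A ^ (-(η * n) : ℝ) ≤ (c * A ^ (-(η - 1) : ℝ)) * (A ^ n)⁻¹ := by
  have hA0 : 0 < A := by linarith
  set x : ℝ := c * A ^ (-(η - 1) : ℝ) with hx
  have hx0 : 0 ≤ x := by rw [hx]; positivity
  have hx1 : x ≤ 1 := by
    rw [hx, Real.rpow_neg hA0.le]
    have hpos : 0 < A ^ (η - 1 : ℝ) := Real.rpow_pos_of_pos hA0 _
    rw [← div_eq_mul_inv, div_le_one hpos]
    exact hcA
  rw [rpow_neg_mul_natCast_eq hA0 n, ← mul_assoc, ← mul_pow]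
  refine mul_le_mul_of_nonneg_right ?_ (by positivity)
  rw [← hx]
  exact pow_le_of_le_one hx0 hx1 (by omega)

/-- The same with the weaker conclusion `c^n A^{−η n} ≤ (A^n)⁻¹`.
[cite: AdamsBuchholzKoteckyMuller2019, proof of Lemma 9.6 (9.39) / Lemma 10.2] -/
theorem pow_mul_rpow_le_inv_pow' {A η c : ℝ} (hA : 1 ≤ A) (hc : 0 ≤ c) (hcA : c ≤ A ^ (η - 1 : ℝ))
    {n : ℕ} (hn : 1 ≤ n) :
    c ^ n * A ^ (-(η * n) : ℝ) ≤ (A ^ n)⁻¹ := by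
  have hA0 : 0 < A := by linarith
  refine (pow_mul_rpow_le_inv_pow hA hc hcA hn).trans ?_
  have hx1 : c * A ^ (-(η - 1) : ℝ) ≤ 1 := by
    rw [Real.rpow_neg hA0.le]
    have hpos : 0 < A ^ (η - 1 : ℝ) := Real.rpow_pos_of_pos hA0 _
    rw [← div_eq_mul_inv, div_le_one hpos]
    exact hcA
  calc c * A ^ (-(η - 1) : ℝ) * (A ^ n)⁻¹ ≤ 1 * (A ^ n)⁻¹ :=
        mul_le_mul_of_nonneg_right hx1 (by positivity)
    _ = (A ^ n)⁻¹ := one_mul _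

end Literature.MathematicalPhysics.StatisticalMechanics.TorusPolymer

end
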